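import Mathlib.LinearAlgebra.Matrix.Rank
import Mathlib.FieldTheory.Finiteness
import Mathlib.Algebra.Field.ZMod
import Mathlib.Analysis.RCLike.Basic
import Mathlib.Combinatorics.SimpleGraph.DegreeSum
import Mathlib.Combinatorics.SimpleGraph.Maps
import HarnessLib

/-!
# Graph states: the Schmidt rank across a cut is `2 ^ rank_𝔽₂(Γ_AB)` (Hein–Eisert–Briegel 2004)

Topic `Literature/Computability/QuantumComplexity` (pub-qadeq lane, CLAIMS row E-46: the classical-cost
basis of Martiel et al. 2026 — "we compute its rank over 𝔽₂ and record the minimum rank observed … a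
minimal rank of 30 … a tensor network based simulator exploiting this particular minimal bipartition
would still need to perform at least 2³⁰ operations" — IS this proposition applied to the graph state
underlying their doped-Clifford circuit; companion of `PostselectedFidelityBound.lean`).

HONEST FRAMING: instance-level adjudication of specific advantage claims; no claim about BQP vs BPP
or the summit. This file proves a published identity about graph states; it says nothing about any
device, any circuit family's hardness, or any tensor-network algorithm's actual cost.

## Sources (verbatim)

[HeinEisertBriegel2004] M. Hein, J. Eisert, H. J. Briegel, *Multiparty entanglement in graph states*,
Phys. Rev. A 69, 062311 (2004) = arXiv:quant-ph/0307130. §3.2 (arXiv p. 10): "For a bipartition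
`(A,B)` of the graph `G = (V,E)` … `Γ_AB` will denote the `|A|×|B|`-off-diagonal submatrix of the
adjacency matrix `Γ_G` according to `G`, which represents the edges between `A` and `B`:
`((Γ_A, Γ_ABᵀ), (Γ_AB, Γ_B)) = Γ_G`". **Proposition 3 (Bi-partitioning).** "The partial trace with
respect to any partition `A` is `tr_A[|G⟩⟨G|] = 2^{-|A|} Σ_{z ∈ 𝔽₂^A} U(z)|G−A⟩⟨G−A|U(z)†` … The
local unitaries are defined as `U(z) = ∏_{a∈A} (∏_{b∈N_a} σ_z^{(b)})^{z_a}`. Therefore, the Schmidt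
measure of a graph state vector `|G⟩` with respect to an arbitrary bipartition `(A,B)` is given by
the rank of the submatrix `Γ_AB` of the adjacency matrix `Γ_G`,
`E_S(|G⟩) ≥ E_S^{(A,B)}(|G⟩) = log₂(rank(tr_A[|G⟩⟨G|])) = rank_{𝔽₂}(Γ_AB) = ½ rank_{𝔽₂}(Γ_{G_AB})`."
Proof (arXiv p. 15–16): measuring `A` with result `z ∈ 𝔽₂^A` leaves
"`(−1)^{⟨z|Γ_{G−B} z⟩} |z⟩ ⊗ ∏_{b∈B} (σ_z^{(b)})^{⟨e^b|Γ_AB z⟩} |G−A⟩`", "the state vectors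
`U(z₁)|G−A⟩` and `U(z₂)|G−A⟩` are orthogonal if and only if `U(z₁ − z₂) ≠ 𝟙`", hence
"`log₂(rank(tr_A[|G⟩⟨G|])) = log₂(dim span{U(z)|G−A⟩ : z ∈ 𝔽₂^A})
 = |A| − log₂|{z ∈ 𝔽₂^A : ⟨e^b|Γ_AB z⟩ =_{𝔽₂} 0 ∀ b ∈ B}| = |A| − dim ker_{𝔽₂}(Γ_AB) = rank_{𝔽₂}(Γ_AB)`."

[MartielEtAl2026] S. Martiel et al. (IBM), *Sampling hard circuits with verifiably high fidelity*,
arXiv:2607.25941v1, SI §S1.1 (PDF p. 16 L17–20): "when computing the bipartite adjacency rank over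
10⁸ random bipartitions in our 70-qubit graph state, we obtain a minimum rank/bipartite entanglement
entropy of 30, which is close to the maximum possible rank of 35"; SI §S9 (PDF p. 118 L11–20): "We
then pick a very large number of random bipartitions of the set of qubits and compute the rank of the
bipartite adjacency matrix induced by that cut (corresponding to an off-diagonal block of `A`) • For
each bipartite adjacency matrix, we compute its rank over 𝔽₂ … If this is the minimal rank, it entails
that a tensor network based simulator exploiting this particular minimal bipartition would still need
to perform at least 2³⁰ operations".

## Rendering and contents (all proved, 0 named facts)

Graph state amplitudes. For a finite simple graph `G` on `V` (Mathlib `SimpleGraph V`) the state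
`|G⟩ = ∏_{(a,b)∈E} U^{(a,b)}|+⟩^{⊗V}`, `U^{(a,b)} = CZ = diag(1,1,1,−1)`, has computational-basis
amplitudes `⟨x|G⟩ = 2^{-|V|/2} ∏_{{a,b}∈E} (−1)^{x_a x_b} = 2^{-|V|/2} (−1)^{#E(G[supp x])}`; we take
this as the rendering: `litEdges G x` (the edges with both endpoint bits `1`), `litEdgeCount`,
`graphSign G x = (−1)^{litEdgeCount G x} ∈ K` (the global `2^{-|V|/2}` is dropped — a nonzero scalar,
irrelevant for ranks), over any field `K`.

The cut. For `V = A ⊕ B` and `G : SimpleGraph (A ⊕ B)`: `crossAdj G : Matrix B A (ZMod 2)` is the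
printed block `Γ_AB`; `litEdgeCount_sum_elim` (edges inside `A` + lit cross edges + edges inside `B`,
via the handshake lemma — private helper `two_mul_litEdgeCount`), `chi_dotProduct_crossAdj`
(`(−1)^{#lit cross edges} = (−1)^{⟨y, Γ_AB z⟩}`) and **`graphSign_sum_elim`** — the printed
factorisation `⟨(z,y)|G⟩ ∝ (−1)^{q_A(z)} · (−1)^{⟨y, Γ_AB z⟩} · ⟨y|G−A⟩`:
`graphSign G (z,y) = graphSign G[A] z · χ(⟨y, Γ_AB z⟩) · graphSign G[B] y` (`G[A] = G.comap inl`).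

The rank computation, for an ARBITRARY factorised matrix `C[z,x] = c_A(z) · (−1)^{⟨x, Γ z⟩} · c_B(x)`
(`cutMatrix c_A c_B Γ`, any `Γ : Matrix B A (ZMod 2)`, any nowhere-zero weights, any field with `2 ≠ 0`):
* `chi a = (−1)^a`, the sign character of `𝔽₂` (`chi_add`, `chi_mul_self`, `chi_ne_zero`);
  `sum_chi_dotProduct` (`Σ_x (−1)^{⟨x,y⟩} = 2^{|B|}·[y = 0]`), `sum_chi_mul_chi` (orthogonality of the
  characters `x ↦ (−1)^{⟨x,y⟩}` — "U(z₁)|G−A⟩ and U(z₂)|G−A⟩ are orthogonal iff U(z₁−z₂) ≠ 𝟙"),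
  `linearIndependent_chi` (distinct characters are linearly independent);
* `signKernel Γ = ((−1)^{⟨x, Γ z⟩})_{z,x}` and `cutMatrix c_A c_B Γ = diag(c_A) · signKernel Γ · diag(c_B)`
  (`cutMatrix_eq`);
* **`rank_signKernel`**: `rank_K(signKernel Γ) = 2 ^ rank_{𝔽₂}(Γ)` — the rows are the characters
  indexed by the IMAGE `{Γ z}` of `Γ`, a subspace with `2^{rank Γ}` elements ("`= |A| − dim ker Γ_AB`");
* **`rank_cutMatrix`**: `rank_K(cutMatrix c_A c_B Γ) = 2 ^ rank_{𝔽₂}(Γ)`; over `ℝ`/`ℂ` (`RCLike`),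
  **`rank_conjTranspose_mul_cutMatrix`**: the reduced operator `C†C` on `B` (`= tr_A|ψ⟩⟨ψ|` up to
  transpose/normalisation) has the same rank — `log₂` Schmidt rank `= rank_{𝔽₂}(Γ_AB)`, the
  "bipartite entanglement entropy = bipartite adjacency rank" used by [MartielEtAl2026];
* **`rank_graphState_cut`** (Proposition 3 for `|G⟩` itself): the amplitude matrix
  `(graphSign G (z,y))_{z ∈ 𝔽₂^A, y ∈ 𝔽₂^B}` has rank `2 ^ rank_{𝔽₂}(crossAdj G)` (`of_graphSign_eq_cutMatrix`).

Not formalised: `|G⟩` as a vector in a tensor-product Hilbert space, its stabiliser description and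
the measurement narrative of the printed proof (we start from the amplitude formula, which the CZ
product gives at once); the Schmidt measure `E_S` and the bound `E_S ≥ E_S^{(A,B)}`; the entropy
statement ("the reduced entropy … and the Schmidt rank coincide"); Proposition 4 (maximal-rank
criteria); rank-width / contraction-complexity statements of [MartielEtAl2026] §S9.
-/

noncomputable section

open Matrix Finset

namespace Literature.Computability.QuantumComplexity

namespace GraphStateCutRank

variable {K : Type*} [Field K]

/-! ### The sign character of `𝔽₂` and the characters of `𝔽₂^B` -/

/-- `χ(a) = (−1)^a ∈ K` for `a ∈ 𝔽₂` (exponent read in `{0,1}`).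
[cite: HeinEisertBriegel2004, Prop. 3 proof ("(σ_z^{(b)})^{⟨e^b|Γ_AB z⟩}", arithmetic "modulo 2")] -/
def chi (a : ZMod 2) : K := (-1) ^ a.val

/-- `χ(0) = 1`. [cite: HeinEisertBriegel2004, Prop. 3 proof] -/
@[simp] theorem chi_zero : (chi 0 : K) = 1 := by
  simp [chi]

/-- `χ(a + b) = χ(a) χ(b)`. [cite: HeinEisertBriegel2004, Prop. 3 proof ("U(z₁ − z₂) = U(z₂)†U(z₁)")] -/
theorem chi_add (a b : ZMod 2) : (chi (a + b) : K) = chi a * chi b := by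
  rw [chi, ZMod.val_add, ← neg_one_pow_eq_pow_mod_two, pow_add, chi, chi]

/-- `χ(a)² = 1`. [cite: HeinEisertBriegel2004, Prop. 3 proof] -/
theorem chi_mul_self (a : ZMod 2) : (chi a : K) * chi a = 1 := by
  rw [chi, ← pow_add, ← two_mul, pow_mul, neg_one_sq, one_pow]

/-- `χ(a) ≠ 0`. [cite: HeinEisertBriegel2004, Prop. 3 proof] -/
theorem chi_ne_zero (a : ZMod 2) : (chi a : K) ≠ 0 := by
  intro h
  have := chi_mul_self (K := K) a
  rw [h, zero_mul] at this
  exact zero_ne_one this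

/-- `χ(a) = −1` for `a ≠ 0`. [cite: HeinEisertBriegel2004, Prop. 3 proof] -/
theorem chi_of_ne_zero {a : ZMod 2} (ha : a ≠ 0) : (chi a : K) = -1 := by
  have : a = 1 := by revert ha; revert a; decide
  subst this
  simp [chi, ZMod.val_one]

variable {B : Type*} [Fintype B] [DecidableEq B]

omit [Fintype B] [DecidableEq B] in
/-- In `𝔽₂^B`, `y + y' = 0 ↔ y = y'`. [folklore] -/
private theorem add_eq_zero_iff_eq' (y y' : B → ZMod 2) : y + y' = 0 ↔ y = y' := by
  simp only [funext_iff, Pi.add_apply, Pi.zero_apply]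
  refine forall_congr' fun b => ?_
  generalize y b = u
  generalize y' b = v
  revert u v
  decide

/-- **Character sum on `𝔽₂^B`**: `Σ_x (−1)^{⟨x,y⟩} = 2^{|B|}` if `y = 0` and `0` otherwise
(needs `2 ≠ 0` in `K`). [cite: HeinEisertBriegel2004, Prop. 3 proof ("∏_{c∈V'} σ_z^{(c)} … takes it
into its orthogonal complement" for `V' ≠ ∅`)] -/
theorem sum_chi_dotProduct [NeZero (2 : K)] (y : B → ZMod 2) :
    ∑ x : B → ZMod 2, (chi (x ⬝ᵥ y) : K) = if y = 0 then (2 : K) ^ Fintype.card B else 0 := by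
  split_ifs with hy
  · subst hy
    simp only [dotProduct_zero, chi_zero, sum_const, card_univ, Fintype.card_fun, ZMod.card,
      nsmul_eq_mul, mul_one, Nat.cast_pow, Nat.cast_ofNat]
  · obtain ⟨b, hb⟩ : ∃ b, y b ≠ 0 := by
      by_contra! h
      exact hy (funext h)
    set S := ∑ x : B → ZMod 2, (chi (x ⬝ᵥ y) : K) with hS
    have hflip : S = -S := by
      calc S = ∑ x : B → ZMod 2, (chi ((x + Pi.single b 1) ⬝ᵥ y) : K) :=
            (Fintype.sum_equiv (Equiv.addRight (Pi.single b 1))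
              (fun x => (chi ((x + Pi.single b 1) ⬝ᵥ y) : K)) (fun x => chi (x ⬝ᵥ y))
              fun _ => rfl).symm
        _ = ∑ x : B → ZMod 2, -(chi (x ⬝ᵥ y) : K) := by
            refine sum_congr rfl fun x _ => ?_
            rw [add_dotProduct, chi_add, single_dotProduct, one_mul, chi_of_ne_zero hb, mul_neg_one]
        _ = -S := sum_neg_distrib ..
    have h2 : (2 : K) * S = 0 := by rw [two_mul]; nth_rewrite 2 [hflip]; exact add_neg_cancel S
    exact (mul_eq_zero.mp h2).resolve_left two_ne_zero

/-- **Orthogonality of the characters** `x ↦ (−1)^{⟨x,y⟩}`: `Σ_x (−1)^{⟨x,y⟩}(−1)^{⟨x,y'⟩} = 2^{|B|}·[y = y']`.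
[cite: HeinEisertBriegel2004, Prop. 3 proof ("U(z₁)|G−A⟩ and U(z₂)|G−A⟩ are orthogonal if and only
if U(z₁ − z₂) ≠ 𝟙")] -/
theorem sum_chi_mul_chi [NeZero (2 : K)] (y y' : B → ZMod 2) :
    ∑ x : B → ZMod 2, (chi (x ⬝ᵥ y) : K) * chi (x ⬝ᵥ y') =
      if y = y' then (2 : K) ^ Fintype.card B else 0 := by
  simp_rw [← chi_add, ← dotProduct_add]
  rw [sum_chi_dotProduct]
  exact if_congr (add_eq_zero_iff_eq' y y') rfl rfl

/-- **Distinct characters are linearly independent** (as vectors in `K^{𝔽₂^B}`).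
[cite: HeinEisertBriegel2004, Prop. 3 proof ("dim span{U(z)|G−A⟩ : z ∈ 𝔽₂^A}")] -/
theorem linearIndependent_chi [NeZero (2 : K)] {ι : Type*} (f : ι → B → ZMod 2)
    (hf : Function.Injective f) :
    LinearIndependent K (fun i => fun x : B → ZMod 2 => (chi (x ⬝ᵥ f i) : K)) := by
  classical
  rw [linearIndependent_iff']
  intro s g hg i hi
  have key := congrArg (fun v : (B → ZMod 2) → K => ∑ x, v x * chi (x ⬝ᵥ f i)) hg
  simp only [Finset.sum_apply, Pi.smul_apply, smul_eq_mul, Pi.zero_apply, zero_mul,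
    Finset.sum_const_zero, Finset.sum_mul] at key
  rw [Finset.sum_comm] at key
  simp_rw [mul_assoc, ← Finset.mul_sum, sum_chi_mul_chi, hf.eq_iff, mul_ite, mul_zero,
    Finset.sum_ite_eq' s i, if_pos hi] at key
  exact (mul_eq_zero.mp key).resolve_right (pow_ne_zero _ two_ne_zero)

/-! ### The amplitude matrix across the cut and its rank -/

variable {A : Type*} [Fintype A] [DecidableEq A]

/-- The sign kernel `H[z, x] = (−1)^{⟨x, Γ z⟩} = ⟨x|U(z)|x⟩`, `U(z) = ∏_{b∈B} (σ_z^{(b)})^{⟨e^b|Γ_AB z⟩}`,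
rows `z ∈ 𝔽₂^A`, columns `x ∈ 𝔽₂^B` (`Γ = Γ_AB`, the `B × A` block of the adjacency matrix).
[cite: HeinEisertBriegel2004, Prop. 3 (eq. "U(z) = ∏_{b∈B} (σ_z^{(b)})^{⟨e^b|Γ_AB z⟩}")] -/
def signKernel (Γ : Matrix B A (ZMod 2)) : Matrix (A → ZMod 2) (B → ZMod 2) K :=
  Matrix.of fun z x => chi (x ⬝ᵥ Γ *ᵥ z)

/-- The amplitude matrix of a graph state across the cut `(A,B)`:
`C[z, x] = c_A(z) · (−1)^{⟨x, Γ_AB z⟩} · c_B(x)` — for `|G⟩` itself `c_A(z) = 2^{-|A|/2}(−1)^{⟨z|Γ_{G−B}z⟩}`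
and `c_B(x) = ⟨x|G−A⟩` (both nowhere zero); here `c_A`, `c_B` are arbitrary weights.
[cite: HeinEisertBriegel2004, Prop. 3 proof (final state "(−1)^{⟨z|Γ_{G−B}z⟩}|z⟩ ⊗ ∏_b (σ_z^{(b)})^{⟨e^b|Γ_AB z⟩}|G−A⟩")] -/
def cutMatrix (cA : (A → ZMod 2) → K) (cB : (B → ZMod 2) → K) (Γ : Matrix B A (ZMod 2)) :
    Matrix (A → ZMod 2) (B → ZMod 2) K :=
  Matrix.of fun z x => cA z * chi (x ⬝ᵥ Γ *ᵥ z) * cB x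

/-- `C = diag(c_A) · H · diag(c_B)`. [cite: HeinEisertBriegel2004, Prop. 3 proof] -/
theorem cutMatrix_eq (cA : (A → ZMod 2) → K) (cB : (B → ZMod 2) → K) (Γ : Matrix B A (ZMod 2)) :
    cutMatrix cA cB Γ = diagonal cA * signKernel Γ * diagonal cB := by
  ext z x
  simp [cutMatrix, signKernel, mul_diagonal, diagonal_mul]

omit [DecidableEq A] in
/-- **The rank of the sign kernel is `2 ^ rank_{𝔽₂}(Γ)`**: its rows are the characters
`x ↦ (−1)^{⟨x,y⟩}` indexed by `y` in the image of `Γ`, pairwise orthogonal, and the image has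
`2^{rank Γ} = 2^{|A| − dim ker Γ}` elements.
[cite: HeinEisertBriegel2004, Prop. 3 (proof: "= |A| − dim ker_{𝔽₂}(Γ_AB) = rank_{𝔽₂}(Γ_AB)")] -/
theorem rank_signKernel [NeZero (2 : K)] (Γ : Matrix B A (ZMod 2)) :
    (signKernel Γ : Matrix (A → ZMod 2) (B → ZMod 2) K).rank = 2 ^ Γ.rank := by
  classical
  let V := LinearMap.range Γ.mulVecLin
  haveI : Fintype ↥V := Fintype.ofFinite _
  have hset : Set.range (signKernel (K := K) Γ).row =
      Set.range (fun y : ↥V => fun x : B → ZMod 2 => (chi (x ⬝ᵥ (y : B → ZMod 2)) : K)) := by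
    ext v
    constructor
    · rintro ⟨z, rfl⟩
      exact ⟨⟨Γ *ᵥ z, LinearMap.mem_range_self Γ.mulVecLin z⟩, rfl⟩
    · rintro ⟨⟨y, z, rfl⟩, rfl⟩
      exact ⟨z, rfl⟩
  rw [rank_eq_finrank_span_row, hset,
    finrank_span_eq_card (linearIndependent_chi (fun y : ↥V => (y : B → ZMod 2))
      Subtype.val_injective),
    Module.card_eq_pow_finrank (K := ZMod 2) (V := ↥V), ZMod.card]
  rfl

/-- **Proposition 3 (Bi-partitioning), rank form**: for nowhere-zero block weights the amplitude
matrix of a graph state across the cut `(A, B)` has rank `2 ^ rank_{𝔽₂}(Γ_AB)` — the Schmidt rank of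
`|G⟩` with respect to `(A,B)` is `2^{rank_{𝔽₂}(Γ_AB)}`, i.e. `E_S^{(A,B)}(|G⟩) = rank_{𝔽₂}(Γ_AB)`.
[cite: HeinEisertBriegel2004, Proposition 3 ("E_S^{(A,B)}(|G⟩) = log₂(rank(tr_A[|G⟩⟨G|])) = rank_{𝔽₂}(Γ_AB)")] -/
theorem rank_cutMatrix [NeZero (2 : K)] {cA : (A → ZMod 2) → K} {cB : (B → ZMod 2) → K}
    (hA : ∀ z, cA z ≠ 0) (hB : ∀ x, cB x ≠ 0) (Γ : Matrix B A (ZMod 2)) :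
    (cutMatrix cA cB Γ).rank = 2 ^ Γ.rank := by
  have hdA : IsUnit (diagonal cA).det := by
    rw [det_diagonal, isUnit_iff_ne_zero]
    exact prod_ne_zero_iff.mpr fun z _ => hA z
  have hdB : IsUnit (diagonal cB).det := by
    rw [det_diagonal, isUnit_iff_ne_zero]
    exact prod_ne_zero_iff.mpr fun x _ => hB x
  rw [cutMatrix_eq, rank_mul_eq_left_of_isUnit_det _ _ hdB, rank_mul_eq_right_of_isUnit_det _ _ hdA,
    rank_signKernel]

omit [DecidableEq B] [DecidableEq A] in
/-- `signKernel` is the weight-free case `c_A = c_B = 1` of `cutMatrix`.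
[cite: HeinEisertBriegel2004, Prop. 3 proof] -/
theorem cutMatrix_one_one (Γ : Matrix B A (ZMod 2)) :
    cutMatrix (fun _ => (1 : K)) (fun _ => 1) Γ = signKernel Γ := by
  ext z x
  simp [cutMatrix, signKernel]

end GraphStateCutRank

namespace GraphStateCutRank

/-! ### Graph states proper: `⟨x|G⟩ = 2^{-|V|/2} (−1)^{#{edges of G inside the support of x}}` and the
factorisation of the amplitude across a cut `V = A ⊕ B` -/

variable {K : Type*} [Field K]
variable {V : Type*} [Fintype V] [DecidableEq V]

/-- The edges of `G` both of whose endpoints carry bit `1` in `x` (as a subgraph on `V`): for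
`|G⟩ = ∏_{(a,b)∈E} U^{(a,b)} |+⟩^{⊗V}` with `U^{(a,b)} = CZ` one has
`⟨x|G⟩ = 2^{-|V|/2} ∏_{{a,b}∈E} (−1)^{x_a x_b} = 2^{-|V|/2} (−1)^{#E(litEdges G x)}`.
[cite: HeinEisertBriegel2004, §2 eq. "|G⟩ = ∏_{(a,b)∈E} U^{{a,b}} |+⟩^{⊗V}" with "U^{(a,b)} ≐ diag(1,1,1,−1)"] -/
def litEdges (G : SimpleGraph V) (x : V → ZMod 2) : SimpleGraph V where
  Adj u v := G.Adj u v ∧ x u = 1 ∧ x v = 1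
  symm := ⟨fun _ _ h => ⟨h.1.symm, h.2.2, h.2.1⟩⟩
  loopless := ⟨fun _ h => G.irrefl h.1⟩

/-- Adjacency in `litEdges G x` is decidable. [folklore] -/
instance litEdges.instDecidableRel (G : SimpleGraph V) [DecidableRel G.Adj] (x : V → ZMod 2) :
    DecidableRel (litEdges G x).Adj := fun u v =>
  inferInstanceAs (Decidable (G.Adj u v ∧ x u = 1 ∧ x v = 1))

/-- `#{edges {a,b} ∈ E : x_a = x_b = 1}`. [cite: HeinEisertBriegel2004, §2 ("controlled σ_z on qubits a and b")] -/
def litEdgeCount (G : SimpleGraph V) [DecidableRel G.Adj] (x : V → ZMod 2) : ℕ :=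
  (litEdges G x).edgeFinset.card

/-- The SIGN of the graph-state amplitude, `2^{|V|/2} ⟨x|G⟩ = ∏_{{a,b}∈E} (−1)^{x_a x_b} = (−1)^{litEdgeCount G x}`
(the normalisation `2^{-|V|/2}` is a nonzero scalar and is dropped).
[cite: HeinEisertBriegel2004, §2 eq. "|G⟩ = ∏_{(a,b)∈E} U^{{a,b}} |+⟩^{⊗V}"] -/
def graphSign (G : SimpleGraph V) [DecidableRel G.Adj] (x : V → ZMod 2) : K :=
  (-1) ^ litEdgeCount G x

omit [DecidableEq V] in
/-- `graphSign ≠ 0`. [cite: HeinEisertBriegel2004, §2] -/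
theorem graphSign_ne_zero (G : SimpleGraph V) [DecidableRel G.Adj] (x : V → ZMod 2) :
    (graphSign G x : K) ≠ 0 :=
  pow_ne_zero _ (neg_ne_zero.mpr one_ne_zero)

omit [Fintype V] [DecidableEq V] in
/-- Bit bookkeeping: `[A ∧ x_u = 1 ∧ x_v = 1] = [A] · x_u · x_v` with the bits read in `ℕ`. [folklore] -/
private theorem ite_and_bits (P : Prop) [Decidable P] (a b : ZMod 2) :
    (if P ∧ a = 1 ∧ b = 1 then 1 else 0 : ℕ) = (if P then 1 else 0) * (a.val * b.val) := by
  by_cases hP : P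
  · simp only [hP, true_and, if_true, one_mul]
    revert a b
    decide
  · simp [hP]

omit [DecidableEq V] in
/-- **Handshake form of the lit-edge count**: `2 · #E(litEdges G x) = Σ_u Σ_v [u ∼ v] x_u x_v`
(ordered pairs). [folklore] (Mathlib `SimpleGraph.sum_degrees_eq_twice_card_edges`) -/
private theorem two_mul_litEdgeCount (G : SimpleGraph V) [DecidableRel G.Adj] (x : V → ZMod 2) :
    2 * litEdgeCount G x = ∑ u, ∑ v, (if G.Adj u v then 1 else 0) * ((x u).val * (x v).val) := by
  rw [litEdgeCount, ← SimpleGraph.sum_degrees_eq_twice_card_edges]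
  refine Finset.sum_congr rfl fun u _ => ?_
  rw [← SimpleGraph.card_neighborFinset_eq_degree, SimpleGraph.neighborFinset_eq_filter,
    Finset.card_filter]
  exact Finset.sum_congr rfl fun v _ => ite_and_bits (G.Adj u v) (x u) (x v)

/-- `χ(n mod 2) = (−1)^n`. [folklore] -/
private theorem chi_natCast (n : ℕ) : (chi (n : ZMod 2) : K) = (-1) ^ n := by
  rw [chi, ZMod.val_natCast, ← neg_one_pow_eq_pow_mod_two]

variable {A B : Type*} [Fintype A] [DecidableEq A] [Fintype B] [DecidableEq B]

/-- `Γ_AB`, the `|B| × |A|` off-diagonal block of the adjacency matrix of a graph on `A ⊕ B`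
("which represents the edges between A and B"). [cite: HeinEisertBriegel2004, §3.2 (block form of Γ_G)] -/
def crossAdj (G : SimpleGraph (A ⊕ B)) [DecidableRel G.Adj] : Matrix B A (ZMod 2) :=
  Matrix.of fun b a => if G.Adj (Sum.inl a) (Sum.inr b) then 1 else 0

/-- `#{cross edges {a,b}, a ∈ A, b ∈ B : z_a = y_b = 1}`. [cite: HeinEisertBriegel2004, §3.2 (edges E_AB between A and B)] -/
def litCrossCount (G : SimpleGraph (A ⊕ B)) [DecidableRel G.Adj] (z : A → ZMod 2) (y : B → ZMod 2) :
    ℕ :=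
  ∑ a, ∑ b, (if G.Adj (Sum.inl a) (Sum.inr b) then 1 else 0) * ((z a).val * (y b).val)

omit [DecidableEq A] [DecidableEq B] in
/-- **Edge bookkeeping across the cut**: the lit edges of `G` on `A ⊕ B` under the configuration
`(z, y)` are the lit edges inside `A`, plus the lit cross edges, plus the lit edges inside `B`.
[cite: HeinEisertBriegel2004, §3.2 ("((Γ_A, Γ_ABᵀ), (Γ_AB, Γ_B)) = Γ_G")] -/
theorem litEdgeCount_sum_elim (G : SimpleGraph (A ⊕ B)) [DecidableRel G.Adj] (z : A → ZMod 2)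
    (y : B → ZMod 2) :
    litEdgeCount G (Sum.elim z y) =
      litEdgeCount (G.comap Sum.inl) z + litCrossCount G z y +
        litEdgeCount (G.comap Sum.inr) y := by
  have h := two_mul_litEdgeCount G (Sum.elim z y)
  have hA : 2 * litEdgeCount (G.comap Sum.inl) z =
      ∑ a, ∑ a', (if G.Adj (Sum.inl a) (Sum.inl a') then 1 else 0) * ((z a).val * (z a').val) :=
    two_mul_litEdgeCount (G.comap Sum.inl) z
  have hB : 2 * litEdgeCount (G.comap Sum.inr) y =
      ∑ b, ∑ b', (if G.Adj (Sum.inr b) (Sum.inr b') then 1 else 0) * ((y b).val * (y b').val) :=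
    two_mul_litEdgeCount (G.comap Sum.inr) y
  have hBA : ∑ b, ∑ a, (if G.Adj (Sum.inr b) (Sum.inl a) then 1 else 0) * ((y b).val * (z a).val) =
      litCrossCount G z y := by
    rw [litCrossCount, Finset.sum_comm]
    refine Finset.sum_congr rfl fun a _ => Finset.sum_congr rfl fun b _ => ?_
    rw [if_congr (G.adj_comm _ _) rfl rfl, mul_comm (y b).val]
  simp only [Fintype.sum_sum_type, Sum.elim_inl, Sum.elim_inr, Finset.sum_add_distrib] at h
  rw [← hA, ← hB, hBA] at h
  unfold litCrossCount at h ⊢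
  omega

omit [DecidableEq A] [DecidableEq B] in
/-- The cross factor is the character of `Γ_AB z` at `y`: `(−1)^{#lit cross edges} = (−1)^{⟨y, Γ_AB z⟩}`.
[cite: HeinEisertBriegel2004, Prop. 3 proof ("∏_{b∈B} (σ_z^{(b)})^{⟨e^b|Γ_AB z⟩}")] -/
theorem chi_dotProduct_crossAdj (G : SimpleGraph (A ⊕ B)) [DecidableRel G.Adj] (z : A → ZMod 2)
    (y : B → ZMod 2) :
    (chi (y ⬝ᵥ crossAdj G *ᵥ z) : K) = (-1) ^ litCrossCount G z y := by
  rw [← chi_natCast]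
  congr 1
  simp only [litCrossCount, Nat.cast_sum, Nat.cast_mul, Nat.cast_ite, Nat.cast_one, Nat.cast_zero,
    ZMod.natCast_val, ZMod.cast_id', id_eq, dotProduct, mulVec, crossAdj, Matrix.of_apply,
    Finset.mul_sum]
  rw [Finset.sum_comm]
  exact Finset.sum_congr rfl fun b _ => Finset.sum_congr rfl fun a _ => by ring

omit [DecidableEq A] [DecidableEq B] in
/-- **The graph-state amplitude factorises across the cut** exactly as in the printed proof:
`2^{|V|/2}⟨(z,y)|G⟩ = [2^{|A|/2}-free sign of G[A] at z] · (−1)^{⟨y, Γ_AB z⟩} · [sign of G[B] = G − A at y]`.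
[cite: HeinEisertBriegel2004, Prop. 3 proof ("(−1)^{⟨z|Γ_{G−B}z⟩}|z⟩ ⊗ ∏_{b∈B}(σ_z^{(b)})^{⟨e^b|Γ_AB z⟩}|G−A⟩")] -/
theorem graphSign_sum_elim (G : SimpleGraph (A ⊕ B)) [DecidableRel G.Adj] (z : A → ZMod 2)
    (y : B → ZMod 2) :
    (graphSign G (Sum.elim z y) : K) =
      graphSign (G.comap Sum.inl) z * chi (y ⬝ᵥ crossAdj G *ᵥ z) *
        graphSign (G.comap Sum.inr) y := by
  rw [graphSign, litEdgeCount_sum_elim, pow_add, pow_add, chi_dotProduct_crossAdj, graphSign,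
    graphSign]

omit [DecidableEq A] [DecidableEq B] in
/-- Hence the amplitude matrix of `|G⟩` across `(A, B)` IS a `cutMatrix` with nowhere-zero weights.
[cite: HeinEisertBriegel2004, Prop. 3 proof] -/
theorem of_graphSign_eq_cutMatrix (G : SimpleGraph (A ⊕ B)) [DecidableRel G.Adj] :
    (Matrix.of fun z y => (graphSign G (Sum.elim z y) : K)) =
      cutMatrix (graphSign (G.comap Sum.inl)) (graphSign (G.comap Sum.inr)) (crossAdj G) := by
  ext z y
  simp only [Matrix.of_apply, cutMatrix, graphSign_sum_elim]

/-- **Proposition 3 for an honest graph state**: the matrix of amplitudes `(⟨(z,y)|G⟩)_{z ∈ 𝔽₂^A, y ∈ 𝔽₂^B}`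
(up to the global factor `2^{-|V|/2}`) has rank `2 ^ rank_{𝔽₂}(Γ_AB)`; i.e. the Schmidt rank of `|G⟩`
across `(A,B)` is `2^{rank_{𝔽₂} Γ_AB}` and `E_S^{(A,B)}(|G⟩) = rank_{𝔽₂}(Γ_AB)`.
[cite: HeinEisertBriegel2004, Proposition 3 ("E_S^{(A,B)}(|G⟩) = log₂(rank(tr_A[|G⟩⟨G|])) = rank_{𝔽₂}(Γ_AB)")]
[cite: MartielEtAl2026, SI §S1.1 (PDF p. 16: "minimum rank/bipartite entanglement entropy of 30")] -/
theorem rank_graphState_cut [NeZero (2 : K)] (G : SimpleGraph (A ⊕ B)) [DecidableRel G.Adj] :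
    (Matrix.of fun z y => (graphSign G (Sum.elim z y) : K)).rank = 2 ^ (crossAdj G).rank := by
  rw [of_graphSign_eq_cutMatrix, rank_cutMatrix (graphSign_ne_zero _) (graphSign_ne_zero _)]

end GraphStateCutRank

namespace GraphStateCutRank

open scoped ComplexOrder

variable {K : Type*} [RCLike K]
variable {A B : Type*} [Fintype A] [DecidableEq A] [Fintype B] [DecidableEq B]

/-- **Proposition 3 for the reduced operator** (over `ℝ` or `ℂ`): `rank(C†C) = 2 ^ rank_{𝔽₂}(Γ_AB)`,
where `C†C` (indices in `𝔽₂^B`) is, up to transposition and the normalisation carried by `c_A, c_B`,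
the reduced state `tr_A[|G⟩⟨G|]`; so `log₂ rank(tr_A[|G⟩⟨G|]) = rank_{𝔽₂}(Γ_AB)` — the
"bipartite entanglement entropy = bipartite adjacency rank over 𝔽₂" invoked by [MartielEtAl2026].
[cite: HeinEisertBriegel2004, Proposition 3 ("log₂(rank(tr_A[|G⟩⟨G|])) = rank_{𝔽₂}(Γ_AB)")]
[cite: MartielEtAl2026, SI §S9 (PDF p. 118: "we compute its rank over 𝔽₂ … at least 2³⁰ operations")] -/
theorem rank_conjTranspose_mul_cutMatrix {cA : (A → ZMod 2) → K} {cB : (B → ZMod 2) → K}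
    (hA : ∀ z, cA z ≠ 0) (hB : ∀ x, cB x ≠ 0) (Γ : Matrix B A (ZMod 2)) :
    ((cutMatrix cA cB Γ)ᴴ * cutMatrix cA cB Γ).rank = 2 ^ Γ.rank := by
  rw [rank_conjTranspose_mul_self, rank_cutMatrix hA hB]

end GraphStateCutRank

end Literature.Computability.QuantumComplexity
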